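import Mathlib
import Summits.NavierStokesRegularity.NavierStokesRegularity.Theorems.ThreadingFluxCentreJetDefs
import Summits.NavierStokesRegularity.NavierStokesRegularity.Theorems.ThreadingFluxCentreJetLocalDriftLaw
import Summits.NavierStokesRegularity.NavierStokesRegularity.Theorems.ThreadingFluxCentreJetLowestTermFacts
import Summits.NavierStokesRegularity.NavierStokesRegularity.Theorems.ThreadingFluxCentreJetTriaxialFrame
import HarnessLib

/-!
# Crux `PoloidalLiouville` (stmt-NavierStokesRegularity-1222, wall W1), crux idea «steady-centre-sieve» (ns-idea-15):
# ★ L1 `TriaxialToroidalJetRigidity` — KERNEL PROOF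

Support file (`--supports stmt-NavierStokesRegularity-1222`, helper; cell `ns-wall-extremal`, ns-wall-eng-7 g6, 0 kit).
`theorem CentreJet.triaxialToroidalJetRigidity : TriaxialToroidalJetRigidity` — the Defs-twin Prop (body VERBATIM = CentreJetSketch
l.317): a real-analytic steady Navier–Stokes flow on a ball, unthreaded about the centre `x₀`, with `V(x₀) = 0`, `ΔV(x₀) = 0`, an
orthonormal eigenbasis of `DV(x₀)` with three distinct eigenvalues, and VANISHING toroidal 2-jet `D²(curl V)(x₀) = 0`, has
`curl V ≡ 0` on the ball.

Proof (assembly of layers (1)–(4)): suppose `ω = curl V` is not locally zero at `x₀`; let `P(y) = Dᵏω(x₀)(y,…,y)` be its lowest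
non-vanishing diagonal Taylor term (ns-wall-eng-5 g6 `AnalyticOrder.exists_order`); `k ≠ 2` by the 2-jet hypothesis.  Localise
`V, p` to global `C³/C²` representatives (ns-wall-eng-7 g5 `exists_contDiff_eventuallyEq_of_ball`); the jet facts (layer (3):
`divergence_lowestTerm`, `tangent_lowestTerm`, `laplacian_lowestTerm`, `loopLaw_lowestTerm`) and `Σ eᵢ = div V(x₀) = 0` feed layer (4)
`TriaxialFrame.eq_zero_of_jetFacts`, which rests on the algebraic core (1) `HarmonicTangent.harmonicTangentRigidity`: `P = 0`,
contradiction.  So `ω` vanishes near `x₀`, hence on the (preconnected) ball by the identity principle.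
The hypothesis `ΔV(x₀) = 0` is not used (it follows from the others).  IMPORT-NEVER-RESTATE (crit-1 L1-P3): ns-wall-eng-5's
`AnalyticOrder` (p691935) and A1/A2 (`eq_zero_of_harmonic_eulerTop_integral`, via file (1)) are imported by name; NO bracket-rigidity
theorem of solid harmonics (ns-wall-eng-3 p690637 / Core A–D, p684047, p687101, p688869) is used anywhere on this route.

HONEST FRAME: L1 is the «λ = 0» cell of the card's degenerate-centre analysis; with it `NoTriaxialVorticalCentre` rests on the
CONJECTURE C1″ alone (`CentreJetSketch.noTriaxialVorticalCentre_of`).  C1/C1*/C1″ untouched; `PoloidalLiouville` (1222) and NS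
regularity OPEN; movement on the wall: 0.
-/

-- the summit and its single sub-problem share the name (CONVENTIONS §1)
set_option linter.dupNamespace false

noncomputable section

namespace Summit.NavierStokesRegularity.NavierStokesRegularity.Theorems.PoloidalLiouville.CentreJet

open Set Function Filter Topology Metric
open scoped ContDiff RealInnerProductSpace
open Literature.Analysis.FluidPDE

/-- `curl` of an analytic field is analytic. -/
theorem analyticOnNhd_curl {V : E3 → E3} {U : Set E3} (hV : AnalyticOnNhd ℝ V U) : AnalyticOnNhd ℝ (curl V) U := by
  rw [curl_eq_curlCLM_comp]
  exact fun x hx => (curlCLM.analyticAt _).comp (hV.fderiv x hx)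

/-- ★ **L1 (CentreJetSketch l.317) `TriaxialToroidalJetRigidity` holds.** -/
theorem triaxialToroidalJetRigidity : TriaxialToroidalJetRigidity := by
  intro V p x₀ ρ hρ hV hp hNS hun hV0 _hΔ hframe h2
  obtain ⟨u, e, hu, he, hSu⟩ := hframe
  have hx₀ : x₀ ∈ ball x₀ ρ := mem_ball_self hρ
  have hball : ball x₀ ρ ∈ 𝓝 x₀ := ball_mem_nhds x₀ hρ
  have hω : AnalyticOnNhd ℝ (curl V) (ball x₀ ρ) := analyticOnNhd_curl hV
  -- it suffices that `curl V` vanishes near `x₀`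
  suffices hzero : curl V =ᶠ[𝓝 x₀] 0 from
    hω.eqOn_zero_of_preconnected_of_eventuallyEq_zero (convex_ball x₀ ρ).isPreconnected hx₀ hzero
  by_contra hne
  -- the order of vanishing of `ω = curl V` at `x₀`
  obtain ⟨k, hlow, ⟨y₀, hy₀⟩, -⟩ := AnalyticOrder.exists_order (hω x₀ hx₀) hne
  -- `k ≠ 2`: the toroidal 2-jet vanishes
  have hk : k ≠ 2 := by
    rintro rfl
    apply hy₀
    rw [iteratedFDeriv_two_apply, h2]
    rfl
  -- localise `V`, `p` to global smooth representatives
  obtain ⟨hVc, hpc, hdiv, heq⟩ := hNS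
  obtain ⟨W, hW, hWV⟩ := exists_contDiff_eventuallyEq_of_ball (n := 3) hρ (hV.contDiffOn_of_completeSpace.of_le le_top)
  obtain ⟨q, hq, hqp⟩ := exists_contDiff_eventuallyEq_of_ball (n := 2) hρ (hp.contDiffOn_of_completeSpace.of_le le_top)
  have hWV' := eventually_eventuallyEq_of_eventuallyEq hWV
  have hqp' := eventually_eventuallyEq_of_eventuallyEq hqp
  have hWω : ContDiffAt ℝ ω W x₀ := ((hV x₀ hx₀).contDiffAt).congr_of_eventuallyEq hWV
  have hW0 : W x₀ = 0 := by rw [hWV.eq_of_nhds, hV0]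
  have hfd : fderiv ℝ W x₀ = fderiv ℝ V x₀ := hWV.fderiv_eq
  have hcurl : curl W =ᶠ[𝓝 x₀] curl V := by
    filter_upwards [hWV'] with z hz
    rw [curl_eq_curlCLM, curl_eq_curlCLM, hz.fderiv_eq]
  have hNS' : ∀ᶠ x in 𝓝 x₀, fderiv ℝ W x (W x) + gradient q x = Laplacian.laplacian W x := by
    filter_upwards [hWV', hqp', hball] with z hz hzq hzb
    rw [hz.fderiv_eq, hz.eq_of_nhds, hzq.gradient_eq, (InnerProductSpace.laplacian_congr_nhds hz).eq_of_nhds]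
    exact heq z hzb
  have hdiv' : ∀ᶠ x in 𝓝 x₀, VectorCalculus.divergence W x = 0 := by
    filter_upwards [hWV', hball] with z hz hzb
    rw [VectorCalculus.divergence, hz.fderiv_eq]
    exact hdiv z hzb
  have htan' : ∀ᶠ x in 𝓝 x₀, ⟪x - x₀, curl W x⟫ = 0 := by
    filter_upwards [hWV', hball] with z hz hzb
    rw [curl_eq_curlCLM, hz.fderiv_eq, ← curl_eq_curlCLM]
    exact hun z hzb
  -- the lowest term, for `W` and for `V`
  have hPk : ∀ n, iteratedFDeriv ℝ n (curl W) x₀ = iteratedFDeriv ℝ n (curl V) x₀ := fun n =>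
    (hcurl.iteratedFDeriv ℝ n).eq_of_nhds
  have hlowW : ∀ n < k, ∀ y : E3, iteratedFDeriv ℝ n (curl W) x₀ (fun _ => y) = 0 := fun n hn y => by
    rw [hPk n]; exact hlow n hn y
  -- the jet facts (layer (3))
  set P : E3 → E3 := fun y => iteratedFDeriv ℝ k (curl W) x₀ (fun _ => y) with hP
  have hdivP : ∀ y, VectorCalculus.divergence P y = 0 :=
    LowestTerm.divergence_lowestTerm (hW.of_le (by norm_num)) hWω k
  have htanP : ∀ y, ⟪y, P y⟫ = 0 := LowestTerm.tangent_lowestTerm hWω htan' hlowW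
  have hharmP : ∀ y, Laplacian.laplacian P y = 0 := LowestTerm.laplacian_lowestTerm hW hq hWω hNS' hdiv' hW0 hlowW
  have hloopP : ∀ y, ⟪y, fderiv ℝ P y (fderiv ℝ V x₀ y) - fderiv ℝ V x₀ (P y)⟫ = 0 := fun y => by
    have h := LowestTerm.loopLaw_lowestTerm hW hq hWω hNS' hdiv' htan' hW0 hlowW y
    rwa [hfd] at h
  -- traceless strain: `Σ eᵢ = div V(x₀) = 0`
  have htr : ∑ i, e i = 0 := by
    obtain ⟨ob, hob⟩ := TriaxialFrame.exists_orthonormalBasis_eq hu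
    have h := hdiv x₀ hx₀
    rw [divergence_eq_sum_inner_fderiv ob] at h
    simp only [hob] at h
    rwa [TriaxialFrame.sum_inner_eigen hu (fderiv ℝ V x₀) hSu] at h
  -- layer (4): `P = 0`, contradicting the choice of `k`
  have hP0 : P = 0 :=
    TriaxialFrame.eq_zero_of_jetFacts P hk (JetCalculus.contDiff_diag k) (fun c y => JetCalculus.diag_smul k c y) hdivP htanP
      hharmP (fderiv ℝ V x₀) u e hu he hSu htr hloopP
  apply hy₀
  rw [← hPk k]
  exact congrFun hP0 y₀

end Summit.NavierStokesRegularity.NavierStokesRegularity.Theorems.PoloidalLiouville.CentreJet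

end
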